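import Literature.NumberTheory.LFunctions.KeiperLiAsymptoticCriteria
import Mathlib.Analysis.Complex.Liouville
import HarnessLib

/-!
# RH-FREE discharge of `Voros2006_eqTS`: the trend of the Keiper–Li coefficients to all orders

LINE 1 — LABEL: RH-FREE.  A proof (`Voros2006_eqTS_holds`) of the named fact `Voros2006_eqTS` of the
statements module `KeiperLiAsymptoticCriteria.lean` (cell `rh-crit/dbl`, seat t13): **[Voros2006] §4,
eqs. (4.4)–(TS), p.7** — unconditionally, for every `N`,

  `S̄_n = (n/2)(H_n − 1 − log 2π) + 1/2 + o(n^{−N})`,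

`S̄_n = liTrend n` the archimedean part ("trend") of `λ_n`, `H_n` the harmonic number.  No definitions,
no new named facts.  bears_on: LADDER-RH L-C/L-P (COLUMN 4 LI).  WHAT THIS IS NOT: an asymptotic
expansion of the Gamma-factor contribution to `λ_n`; no zero of `ζ` is involved and nothing here bears
on the truth of RH.

## The printed proof and the road taken here

Voros obtains (TS) from a Nörlund–Rice integral `J(σ)` for `Ŝ_n = Σ_{j=2}^n (−1)^j C(n,j)(1−2^{−j})ζ(j)`:
the double pole at `σ = 1` gives `½ n[ψ(n) + log 2 − 1 + 2γ]` and «(mod o(n^{−N}) ∀N > 0) because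
`J(σ)` has no further singularities» ([Voros2006] (4.4)–(4.6), p.7).  The tree has no residue calculus
for such integrals, so we DEVIATE and push the elementary generating-function route of
`KeiperLiTrend.lean` (which proves the same centring with errors `O(1)` and `O(1/n)`) to every order:

1. (`KeiperLiTrend.keiperLiCoeff_sub_osc_eq_iteratedDeriv`, tree) `S̄_{m+1} = Re 𝒜^{(m)}(0)/m!` for the
   generating function `𝒜(z) = L + (−Log π/2 + ψ(L/2)/2) L²`, `L = 1/(1−z)` (`liMap`), `ψ` the digamma
   function.
2. (`VorosTS.trendGen_eq`) For every order `ν ≥ 1`, Stirling's series with remainder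
   `R_ν(w) = ψ(w) − Log w + 1/(2w) + Σ_{k=1}^{ν} B_{2k}/(2k w^{2k})` splits
   `𝒜 = E + Φ_ν − P_ν`, with the elementary part `E = L/2 − 1/6 − (log π/2)L² + L² Log(L/2)/2` whose
   Taylor coefficients are EXACTLY `[zᵐ]E = ((m+1)/2)(H_{m+1} − 1 − log 2π) + 1/2` (`m ≥ 1`,
   `VorosTS.iteratedDeriv_trendElem_zero`), the remainder part `Φ_ν = (L²/2) R_ν(L/2)`, and the
   higher Stirling terms `P_ν(z) = Σ_{k=2}^{ν} (B_{2k}/2k) 2^{2k−1} (1−z)^{2k−2}` — a POLYNOMIAL of degree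
   `2ν − 2`, invisible in the Taylor coefficients of order `≥ 2ν − 1`
   (`VorosTS.iteratedDeriv_trendPoly_eq_zero`).  This is why the printed main term is exact in the
   variable `H_n`: `(n/2)(H_n − 1 − log 2π) + 1/2 ∼ ½ n(log n − 1 + γ − log 2π) + 3/4 − Σ_k B_{2k}/(4k) n^{1−2k}`
   is precisely Voros's (TS).
3. (`VorosTS.norm_rem_le`) On the half-plane `Re z < 1` (where `Re L > 0`) the tree's explicit Stirling
   bound of every order (`Literature.Analysis.SpecialFunctions.Complex.norm_digamma_sub_stirlingSeries_le`,
   `‖R_ν(w)‖ ≤ A_ν/(‖w‖^{2ν} Re w)`) gives `‖Φ_ν(z)‖ ≤ A_ν 4^ν ‖1−z‖^{2ν}/(1 − Re z)`.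
4. (`VorosTS.norm_iteratedDeriv_le_of_growth`) Cauchy's estimate on the discs `B(z, (1−Re z)/2) ⊂
   {Re < 1}` together with `‖1−z‖² ≤ 2(1 − Re z)` on the unit disc bounds the `K`-th derivative:
   `‖Φ_ν^{(K)}‖ ≤ K!·A_ν 4^{3ν}` on `|z| < 1` as soon as `2ν ≥ 2K + 2`.
5. (`VorosTS.norm_iteratedDeriv_add_le`) Cauchy's estimate at `0` for `Φ_ν^{(K)}` on `|z| = r → 1⁻`:
   `‖Φ_ν^{(m+K)}(0)‖ ≤ m!·K!·A_ν 4^{3ν}`, i.e. `|[zⁿ]Φ_ν| ≤ M m!/(m+K)! = O(n^{−K})`.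
6. With `K = N + 1`, `ν = N + 2`: `S̄_n − ((n/2)(H_n − 1 − log 2π) + 1/2) = O(n^{−N−1}) = o(n^{−N})`.

## References

* [Voros2006] A. Voros, *Sharpenings of Li's criterion for the Riemann Hypothesis*, Math. Phys. Anal.
  Geom. 9 (2006) 53–63 = arXiv:math/0506326v2, §4 eqs. (4.2)–(4.6), (TN), (TS), p.7.
* G. E. Andrews, R. Askey, R. Roy, *Special Functions* (1999), Cor. 1.4.5 (Stirling's series for `ψ`).
  [AndrewsAskeyRoy1999]
-/

noncomputable section

open Complex Filter Topology Set Metric Finset Asymptotics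
open scoped Nat

namespace Literature.NumberTheory.LFunctions

namespace VorosTS

/-! ### The Li map on the half-plane `Re z < 1` -/

/-- `Re z < 1 ⟹ z ≠ 1`. [folklore] -/
private theorem ne_one_of_re_lt_one {z : ℂ} (hz : z.re < 1) : z ≠ 1 := fun h ↦ by simp [h] at hz

/-- `|z| < 1 ⟹ Re z < 1`. [folklore] -/
private theorem re_lt_one_of_norm_lt_one {z : ℂ} (hz : ‖z‖ < 1) : z.re < 1 :=
  lt_of_le_of_lt (Complex.re_le_norm z) hz

/-- `m(z) ≠ 0` for `z ≠ 1`. [folklore] -/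
private theorem liMap_ne_zero {z : ℂ} (hz : z ≠ 1) : liMap z ≠ 0 :=
  inv_ne_zero (sub_ne_zero.2 (Ne.symm hz))

/-- `|m(z)| = 1/|1 − z|`. [folklore] -/
private theorem norm_liMap (z : ℂ) : ‖liMap z‖ = ‖1 - z‖⁻¹ := by
  simp [liMap]

/-- `Re m(z) = (1 − Re z)/|1 − z|²`. [folklore] -/
private theorem re_liMap (z : ℂ) : (liMap z).re = (1 - z.re) / ‖1 - z‖ ^ 2 := by
  rw [liMap, Complex.inv_re, Complex.normSq_eq_norm_sq]
  simp

/-- The Li map sends the half-plane `Re z < 1` into the right half-plane. [folklore] -/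
private theorem re_liMap_pos {z : ℂ} (hz : z.re < 1) : 0 < (liMap z).re := by
  rw [re_liMap]
  have h1 : 0 < ‖1 - z‖ := norm_pos_iff.2 (sub_ne_zero.2 (ne_one_of_re_lt_one hz).symm)
  exact div_pos (by linarith) (pow_pos h1 2)

/-- On `Re z < 1`, `m(z)/2` lies in the right half-plane. [folklore] -/
private theorem re_liMap_half_pos {z : ℂ} (hz : z.re < 1) : 0 < (liMap z / 2).re := by
  rw [Complex.div_ofNat_re]
  exact div_pos (re_liMap_pos hz) two_pos

/-- On the closed unit disc, `|1 − z|² ≤ 2(1 − Re z)`. [folklore] -/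
private theorem norm_one_sub_sq_le {z : ℂ} (hz : ‖z‖ ≤ 1) : ‖1 - z‖ ^ 2 ≤ 2 * (1 - z.re) := by
  have h1 : ‖1 - z‖ ^ 2 = (1 - z.re) ^ 2 + z.im ^ 2 := by
    rw [Complex.sq_norm, Complex.normSq_apply]
    simp
    ring
  have h2 : z.re * z.re + z.im * z.im ≤ 1 := by
    have h3 : ‖z‖ ^ 2 ≤ 1 := by nlinarith [norm_nonneg z]
    rwa [Complex.sq_norm, Complex.normSq_apply] at h3
  nlinarith

/-! ### The elementary part `E` of the generating function and its Taylor coefficients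

(As in `KeiperLiTrend.lean`, whose corresponding lemmas are private; restated here over the half-plane
`Re z < 1` and in terms of Mathlib's harmonic numbers.) -/

/-- The harmonic number as a complex sum: `H_n = Σ_{i<n} 1/(i+1)`. [folklore] -/
private theorem harmonic_cast_eq_sum (n : ℕ) :
    (((harmonic n : ℚ) : ℝ) : ℂ) = ∑ i ∈ Finset.range n, ((i : ℂ) + 1)⁻¹ := by
  simp [harmonic]

/-- On `Re z < 1`, `d/dz Log(m(z)/2) = m(z)`. [folklore] -/
private theorem hasDerivAt_log_liMap_half {z : ℂ} (hz : z.re < 1) :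
    HasDerivAt (fun z ↦ Complex.log (liMap z / 2)) (liMap z) z := by
  have hz1 := ne_one_of_re_lt_one hz
  have hsl : liMap z / 2 ∈ slitPlane := Complex.mem_slitPlane_iff.2 (Or.inl (re_liMap_half_pos hz))
  have h1 : HasDerivAt (fun z ↦ liMap z / 2) (liMap z ^ 2 / 2) z :=
    (hasDerivAt_liMap hz1).div_const 2
  convert h1.clog hsl using 1
  have h0 := liMap_ne_zero hz1
  field_simp

/-- `Log(m(·)/2)` is analytic on `Re z < 1`. [folklore] -/
private theorem analyticAt_log_liMap_half {z : ℂ} (hz : z.re < 1) :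
    AnalyticAt ℂ (fun z ↦ Complex.log (liMap z / 2)) z :=
  ((analyticAt_liMap (ne_one_of_re_lt_one hz)).div analyticAt_const two_ne_zero).clog
    (Complex.mem_slitPlane_iff.2 (Or.inl (re_liMap_half_pos hz)))

/-- Leibniz: `d^N/dz^N [(Log(m(z)/2) − 1) · m(z)](0) = N! (H_N − 1 − log 2)`. [folklore] -/
private theorem iteratedDeriv_log_liMap_half_mul_zero (N : ℕ) :
    iteratedDeriv N (fun z ↦ (-1 + Complex.log (liMap z / 2)) * liMap z) 0 =
      (N ! : ℂ) * ((((harmonic N : ℚ) : ℝ) : ℂ) - 1 - Real.log 2) := by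
  have h0re : (0 : ℂ).re < 1 := by simp
  -- `d^{i+1}/dz^{i+1} [Log(m(z)/2)](0) = i!`
  have hsucc : ∀ i : ℕ, iteratedDeriv (i + 1) (fun z ↦ Complex.log (liMap z / 2)) 0 = (i ! : ℂ) := by
    intro i
    rw [iteratedDeriv_succ']
    have hev : deriv (fun z ↦ Complex.log (liMap z / 2)) =ᶠ[𝓝 (0 : ℂ)] liMap := by
      filter_upwards [(isOpen_lt Complex.continuous_re continuous_const).mem_nhds h0re] with z hz
      exact (hasDerivAt_log_liMap_half hz).deriv
    rw [hev.iteratedDeriv_eq, iteratedDeriv_liMap_zero]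
  have hF : ContDiffAt ℂ N (fun z ↦ -1 + Complex.log (liMap z / 2)) 0 :=
    (analyticAt_const.add (analyticAt_log_liMap_half h0re)).contDiffAt
  have hL : ContDiffAt ℂ N liMap 0 := (analyticAt_liMap zero_ne_one).contDiffAt
  rw [harmonic_cast_eq_sum, iteratedDeriv_fun_mul hF hL, Finset.sum_range_succ']
  have hlog : Complex.log (1 / 2) = -Real.log 2 := by
    rw [show (1 / 2 : ℂ) = ((1 / 2 : ℝ) : ℂ) by push_cast; ring, ← Complex.ofReal_log (by norm_num),
      show (1 / 2 : ℝ) = 2⁻¹ by norm_num, Real.log_inv]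
    push_cast; ring
  have h0 : iteratedDeriv 0 (fun z ↦ -1 + Complex.log (liMap z / 2)) 0 = -1 - Real.log 2 := by
    rw [iteratedDeriv_zero, liMap_zero, hlog]; ring
  have hS : ∀ i ∈ Finset.range N, (N.choose (i + 1) : ℂ) *
      iteratedDeriv (i + 1) (fun z ↦ -1 + Complex.log (liMap z / 2)) 0 *
      iteratedDeriv (N - (i + 1)) liMap 0 = (N ! : ℂ) * ((i : ℂ) + 1)⁻¹ := by
    intro i hi
    have hi' : i + 1 ≤ N := Finset.mem_range.1 hi
    rw [iteratedDeriv_const_add (Nat.succ_pos i), iteratedDeriv_liMap_zero, hsucc]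
    have hc := congrArg (Nat.cast : ℕ → ℂ) (Nat.choose_mul_factorial_mul_factorial hi')
    push_cast [Nat.factorial_succ] at hc
    have hi0 : ((i : ℂ) + 1) ≠ 0 := by exact_mod_cast Nat.succ_ne_zero i
    field_simp
    linear_combination hc
  rw [Finset.sum_congr rfl hS, h0, ← Finset.mul_sum, Nat.choose_zero_right, Nat.sub_zero,
    iteratedDeriv_liMap_zero]
  push_cast
  ring

/-- **Taylor coefficients of `m(z)² Log(m(z)/2)`**: `dᵐ/dzᵐ [m² Log(m/2)](0) = (m+1)! (H_{m+1} − 1 − log 2)`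
(`m² Log(m/2)` is the derivative of `(Log(m/2) − 1)·m`). [folklore] -/
private theorem iteratedDeriv_liMap_sq_mul_log_zero (m : ℕ) :
    iteratedDeriv m (fun z ↦ liMap z ^ 2 * Complex.log (liMap z / 2)) 0 =
      ((m + 1)! : ℂ) * ((((harmonic (m + 1) : ℚ) : ℝ) : ℂ) - 1 - Real.log 2) := by
  have hev : (fun z ↦ liMap z ^ 2 * Complex.log (liMap z / 2)) =ᶠ[𝓝 (0 : ℂ)]
      deriv (fun z ↦ (-1 + Complex.log (liMap z / 2)) * liMap z) := by
    filter_upwards [(isOpen_lt Complex.continuous_re continuous_const).mem_nhds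
      (by simp : (0 : ℂ).re < 1)] with z hz
    have h1 := hasDerivAt_log_liMap_half hz
    have h2 := hasDerivAt_liMap (ne_one_of_re_lt_one hz)
    have h3 : HasDerivAt (fun z ↦ (-1 + Complex.log (liMap z / 2)) * liMap z)
        (liMap z * liMap z + (-1 + Complex.log (liMap z / 2)) * liMap z ^ 2) z :=
      (h1.const_add (-1)).mul h2
    rw [h3.deriv]
    ring
  rw [hev.iteratedDeriv_eq, ← iteratedDeriv_succ', iteratedDeriv_log_liMap_half_mul_zero]

/-- The elementary part `E(z) = L/2 − 1/6 − (log π/2) L² + L² Log(L/2)/2` (`L = m(z)`) is analytic at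
`0`. [folklore] -/
private theorem analyticAt_trendElem_zero :
    AnalyticAt ℂ (fun z ↦ liMap z / 2 - 1 / 6 - (Real.log Real.pi : ℂ) / 2 * liMap z ^ 2 +
        liMap z ^ 2 * Complex.log (liMap z / 2) / 2) 0 := by
  have hA : AnalyticAt ℂ liMap 0 := analyticAt_liMap zero_ne_one
  exact (((hA.div analyticAt_const two_ne_zero).sub analyticAt_const).sub
    (analyticAt_const.mul (hA.pow 2))).add (((hA.pow 2).mul
      (analyticAt_log_liMap_half (by simp))).div analyticAt_const two_ne_zero)

/-- **Taylor coefficients of the elementary part**: with `L = m(z)`,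
`E(z) = L/2 − 1/6 − (log π/2) L² + L² Log(L/2)/2` has
`dᵐE/dzᵐ(0)/m! = (m+1)/2 · (H_{m+1} − 1 − log 2 − log π) + 1/2 − [m = 0]/6`. [folklore] -/
private theorem iteratedDeriv_trendElem_zero (m : ℕ) :
    iteratedDeriv m (fun z ↦ liMap z / 2 - 1 / 6 - (Real.log Real.pi : ℂ) / 2 * liMap z ^ 2 +
        liMap z ^ 2 * Complex.log (liMap z / 2) / 2) 0 =
      (m ! : ℂ) * (((m : ℂ) + 1) / 2 * ((((harmonic (m + 1) : ℚ) : ℝ) : ℂ) - 1 -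
        Real.log 2 - Real.log Real.pi) + 1 / 2 - if m = 0 then 1 / 6 else 0) := by
  have hA : AnalyticAt ℂ liMap 0 := analyticAt_liMap zero_ne_one
  -- `dᵐ/dzᵐ [m(z)²](0) = (m+1)!`
  have hsq : iteratedDeriv m (fun z ↦ liMap z ^ 2) 0 = ((m + 1)! : ℂ) := by
    have hev : (fun z ↦ liMap z ^ 2) =ᶠ[𝓝 (0 : ℂ)] deriv liMap := by
      filter_upwards [eventually_ne_nhds (zero_ne_one : (0 : ℂ) ≠ 1)] with z hz
      exact (hasDerivAt_liMap hz).deriv.symm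
    rw [hev.iteratedDeriv_eq, ← iteratedDeriv_succ', iteratedDeriv_liMap_zero]
  have h1 : ContDiffAt ℂ m (fun z ↦ liMap z / 2) 0 := (hA.div analyticAt_const two_ne_zero).contDiffAt
  have h2 : ContDiffAt ℂ m (fun _ : ℂ ↦ (1 / 6 : ℂ)) 0 := contDiffAt_const
  have h3 : ContDiffAt ℂ m (fun z ↦ (Real.log Real.pi : ℂ) / 2 * liMap z ^ 2) 0 :=
    (analyticAt_const.mul (hA.pow 2)).contDiffAt
  have h4 : ContDiffAt ℂ m (fun z ↦ liMap z ^ 2 * Complex.log (liMap z / 2) / 2) 0 :=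
    (((hA.pow 2).mul (analyticAt_log_liMap_half (by simp))).div analyticAt_const
      two_ne_zero).contDiffAt
  rw [iteratedDeriv_fun_add ((h1.sub h2).sub h3) h4, iteratedDeriv_fun_sub (h1.sub h2) h3,
    iteratedDeriv_fun_sub h1 h2, iteratedDeriv_div_const, iteratedDeriv_liMap_zero,
    iteratedDeriv_const, iteratedDeriv_const_mul_field ((Real.log Real.pi : ℂ) / 2) (fun z ↦ liMap z ^ 2),
    hsq, iteratedDeriv_div_const, iteratedDeriv_liMap_sq_mul_log_zero]
  split_ifs with hm
  · subst hm; push_cast; ring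
  · push_cast [Nat.factorial_succ]; ring

/-! ### Cauchy's estimates: growth on `Re z < 1` ⟹ bounded derivatives on the disc ⟹ coefficient decay -/

/-- **Derivative bound from a growth bound.**  If `Φ` is holomorphic on `Re z < 1` with
`‖Φ(u)‖ ≤ C ‖1−u‖^p/(1 − Re u)` there and `p ≥ 2K + 2`, then `‖Φ^{(K)}(z)‖ ≤ K!·C·4^p` on the unit disc
(Cauchy's estimate on the disc `B(z, (1 − Re z)/2)`, on which `1 − Re u ≥ (1 − Re z)/2` and
`‖1−u‖ ≤ 2‖1−z‖`, and `‖1−z‖² ≤ 2(1 − Re z)`). [folklore] -/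
private theorem norm_iteratedDeriv_le_of_growth {Φ : ℂ → ℂ} {C : ℝ} {p K : ℕ} (hC : 0 ≤ C)
    (hp : 2 * K + 2 ≤ p) (hd : DifferentiableOn ℂ Φ {z : ℂ | z.re < 1})
    (hb : ∀ u : ℂ, u.re < 1 → ‖Φ u‖ ≤ C * ‖1 - u‖ ^ p / (1 - u.re))
    {z : ℂ} (hz : ‖z‖ < 1) : ‖iteratedDeriv K Φ z‖ ≤ K ! * (C * 4 ^ p) := by
  have hzre : z.re < 1 := re_lt_one_of_norm_lt_one hz
  set ρ : ℝ := (1 - z.re) / 2 with hρ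
  have hρ0 : 0 < ρ := by rw [hρ]; linarith
  set t : ℝ := ‖1 - z‖ with ht
  have hzre' : (1 - z).re ≤ ‖1 - z‖ := Complex.re_le_norm _
  have hρt : ρ ≤ t := by
    rw [hρ, ht]
    simp only [Complex.sub_re, Complex.one_re] at hzre'
    linarith
  have ht2 : t ≤ 2 := by
    rw [ht]
    calc ‖1 - z‖ ≤ ‖(1 : ℂ)‖ + ‖z‖ := norm_sub_le _ _
      _ ≤ 2 := by rw [norm_one]; linarith
  have htρ : t ^ 2 ≤ 4 * ρ := by
    have := norm_one_sub_sq_le hz.le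
    rw [hρ, ht]; linarith
  -- the closed disc `|u − z| ≤ ρ` lies in the half-plane
  have hsub : closedBall z ρ ⊆ {u : ℂ | u.re < 1} := by
    intro u hu
    have h1 : ‖u - z‖ ≤ ρ := mem_closedBall_iff_norm.1 hu
    have h2 : (u - z).re ≤ ‖u - z‖ := Complex.re_le_norm _
    simp only [Complex.sub_re, Set.mem_setOf_eq] at h2 ⊢
    rw [hρ] at h1
    linarith
  have hdc : DiffContOnCl ℂ Φ (ball z ρ) := hd.diffContOnCl_ball hsub
  -- the bound on the circle
  have hB : ∀ u ∈ sphere z ρ, ‖Φ u‖ ≤ C * (2 * t) ^ p / ρ := by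
    intro u hu
    have h1 : ‖u - z‖ = ρ := mem_sphere_iff_norm.1 hu
    have hure : u.re < 1 := hsub (sphere_subset_closedBall hu)
    have h2 : ρ ≤ 1 - u.re := by
      have h3 : (u - z).re ≤ ‖u - z‖ := Complex.re_le_norm _
      simp only [Complex.sub_re] at h3
      rw [hρ] at h1 ⊢
      linarith
    have h3 : ‖1 - u‖ ≤ 2 * t := by
      have e : (1 : ℂ) - u = (1 - z) + (z - u) := by ring
      calc ‖1 - u‖ = ‖(1 - z) + (z - u)‖ := by rw [e]
        _ ≤ ‖1 - z‖ + ‖z - u‖ := norm_add_le _ _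
        _ = t + ρ := by rw [ht, ← h1, norm_sub_rev z u]
        _ ≤ 2 * t := by linarith
    calc ‖Φ u‖ ≤ C * ‖1 - u‖ ^ p / (1 - u.re) := hb u hure
      _ ≤ C * (2 * t) ^ p / ρ := by gcongr
  have hc := Complex.norm_iteratedDeriv_le_of_forall_mem_sphere_norm_le K hρ0 hdc hB
  refine hc.trans ?_
  -- `K! (C (2t)^p/ρ)/ρ^K ≤ K! C 4^p`
  obtain ⟨q, rfl⟩ : ∃ q, p = q + (2 * K + 2) := ⟨p - (2 * K + 2), by omega⟩
  have key : (2 * t) ^ (q + (2 * K + 2)) ≤ 4 ^ (q + (2 * K + 2)) * ρ ^ (K + 1) := by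
    have h1 : (2 * t) ^ q ≤ 4 ^ q := pow_le_pow_left₀ (by positivity) (by linarith) q
    have h2 : (2 * t) ^ (2 * K + 2) ≤ 4 ^ (2 * K + 2) * ρ ^ (K + 1) := by
      rw [show 2 * K + 2 = 2 * (K + 1) by ring, pow_mul, pow_mul, ← mul_pow]
      apply pow_le_pow_left₀ (by positivity)
      nlinarith
    rw [pow_add, pow_add (4 : ℝ)]
    calc (2 * t) ^ q * (2 * t) ^ (2 * K + 2) ≤ 4 ^ q * (4 ^ (2 * K + 2) * ρ ^ (K + 1)) := by
          gcongr
      _ = 4 ^ q * 4 ^ (2 * K + 2) * ρ ^ (K + 1) := by ring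
  have hρK : 0 < ρ ^ (K + 1) := pow_pos hρ0 _
  have hquot : (2 * t) ^ (q + (2 * K + 2)) / ρ ^ (K + 1) ≤ 4 ^ (q + (2 * K + 2)) := by
    rw [div_le_iff₀ hρK]; exact key
  have e : (K ! : ℝ) * (C * (2 * t) ^ (q + (2 * K + 2)) / ρ) / ρ ^ K =
      K ! * C * ((2 * t) ^ (q + (2 * K + 2)) / ρ ^ (K + 1)) := by
    rw [pow_succ]
    field_simp
  rw [e, mul_assoc]
  gcongr

/-- **Coefficient decay from a derivative bound.**  If `Φ` is holomorphic on `Re z < 1` and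
`‖Φ^{(K)}‖ ≤ M` on the unit disc, then `‖Φ^{(m+K)}(0)‖ ≤ m!·M` for every `m` (Cauchy's inequality for
`Φ^{(K)}` on `|z| = r`, `r → 1⁻`). [folklore] -/
private theorem norm_iteratedDeriv_add_le {Φ : ℂ → ℂ} {M : ℝ} {K : ℕ}
    (hd : DifferentiableOn ℂ Φ {z : ℂ | z.re < 1})
    (hM : ∀ z ∈ ball (0 : ℂ) 1, ‖iteratedDeriv K Φ z‖ ≤ M) (m : ℕ) :
    ‖iteratedDeriv (m + K) Φ 0‖ ≤ m ! * M := by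
  have hopen : IsOpen {z : ℂ | z.re < 1} := isOpen_lt Complex.continuous_re continuous_const
  have han : AnalyticOnNhd ℂ (iteratedDeriv K Φ) {z : ℂ | z.re < 1} := by
    rw [iteratedDeriv_eq_iterate]
    exact (hd.analyticOnNhd hopen).iterated_deriv K
  have hdK : DifferentiableOn ℂ (iteratedDeriv K Φ) (ball 0 1) :=
    han.differentiableOn.mono fun z hz ↦ re_lt_one_of_norm_lt_one (by simpa using hz)
  have e : iteratedDeriv (m + K) Φ = iteratedDeriv m (iteratedDeriv K Φ) := by
    simp only [iteratedDeriv_eq_iterate, Function.iterate_add_apply]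
  rw [e]
  -- Cauchy's inequality on `|z| = r < 1`, then `r → 1⁻`
  set Ψ := iteratedDeriv K Φ with hΨ
  have key : ∀ r : ℝ, 0 < r → r < 1 → ‖iteratedDeriv m Ψ 0‖ ≤ m ! * M / r ^ m := by
    intro r hr0 hr1
    have hsub : closedBall (0 : ℂ) r ⊆ ball 0 1 := closedBall_subset_ball hr1
    have hdc : DiffContOnCl ℂ Ψ (ball 0 r) := hdK.diffContOnCl_ball hsub
    exact Complex.norm_iteratedDeriv_le_of_forall_mem_sphere_norm_le m hr0 hdc
      fun z hz ↦ hM z (hsub (sphere_subset_closedBall hz))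
  have hpow : Tendsto (fun r : ℝ ↦ r ^ m) (𝓝[<] (1 : ℝ)) (𝓝 1) := by
    have h := ((continuous_pow m).tendsto (1 : ℝ)).mono_left (nhdsWithin_le_nhds (s := Iio 1))
    simpa using h
  have hlim : Tendsto (fun r : ℝ ↦ (m ! : ℝ) * M / r ^ m) (𝓝[<] (1 : ℝ)) (𝓝 ((m ! : ℝ) * M)) := by
    have h := (tendsto_const_nhds (x := (m ! : ℝ) * M)).div hpow one_ne_zero
    rw [div_one] at h
    exact h
  refine ge_of_tendsto hlim ?_
  filter_upwards [Ioo_mem_nhdsLT one_pos] with r hr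
  exact key r hr.1 hr.2

/-! ### The remainder part `Φ_ν = (L²/2) R(L/2)` for a remainder `R` of Stirling type -/

/-- `Φ(z) = (L²/2) R(L/2)` is holomorphic on `Re z < 1` when `R` is holomorphic on `Re w > 0`. [folklore] -/
private theorem differentiableOn_rem {R : ℂ → ℂ} (hR : DifferentiableOn ℂ R {w : ℂ | 0 < w.re}) :
    DifferentiableOn ℂ (fun z ↦ liMap z ^ 2 / 2 * R (liMap z / 2)) {z : ℂ | z.re < 1} := by
  intro z hz
  have hz' : z.re < 1 := hz
  have hz1 := ne_one_of_re_lt_one hz'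
  have hL : DifferentiableAt ℂ liMap z := (hasDerivAt_liMap hz1).differentiableAt
  have hw : 0 < (liMap z / 2).re := re_liMap_half_pos hz'
  have hRw : DifferentiableAt ℂ R (liMap z / 2) :=
    (hR _ hw).differentiableAt ((isOpen_lt continuous_const Complex.continuous_re).mem_nhds hw)
  have hcomp : DifferentiableAt ℂ (fun z ↦ R (liMap z / 2)) z := hRw.comp z (hL.div_const 2)
  exact (((hL.pow 2).div_const 2).mul hcomp).differentiableWithinAt

/-- **Growth of the remainder part.**  If `‖R(w)‖ ≤ A/(‖w‖^{2ν} Re w)` on `Re w > 0`, then on `Re u < 1`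
`‖(L²/2) R(L/2)‖ ≤ A 4^ν ‖1−u‖^{2ν}/(1 − Re u)` (`Re L = (1 − Re u)‖L‖²`, `‖L‖ = 1/‖1−u‖`). [folklore] -/
private theorem norm_rem_le {R : ℂ → ℂ} {A : ℝ} {ν : ℕ}
    (hA : ∀ w : ℂ, 0 < w.re → ‖R w‖ ≤ A / (‖w‖ ^ (2 * ν) * w.re)) {u : ℂ} (hu : u.re < 1) :
    ‖liMap u ^ 2 / 2 * R (liMap u / 2)‖ ≤ A * 4 ^ ν * ‖1 - u‖ ^ (2 * ν) / (1 - u.re) := by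
  have hu1 := ne_one_of_re_lt_one hu
  have ht : 0 < ‖1 - u‖ := norm_pos_iff.2 (sub_ne_zero.2 hu1.symm)
  have hs : 0 < 1 - u.re := by linarith
  have hw : 0 < (liMap u / 2).re := re_liMap_half_pos hu
  have hnL : ‖liMap u‖ = ‖1 - u‖⁻¹ := norm_liMap u
  have hreL : (liMap u / 2).re = (1 - u.re) / ‖1 - u‖ ^ 2 / 2 := by
    rw [Complex.div_ofNat_re, re_liMap]
  have hn2 : ‖liMap u / 2‖ = ‖1 - u‖⁻¹ / 2 := by
    rw [norm_div, hnL]; simp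
  rw [norm_mul, norm_div, norm_pow, hnL]
  simp only [RCLike.norm_ofNat]
  calc ‖1 - u‖⁻¹ ^ 2 / 2 * ‖R (liMap u / 2)‖
      ≤ ‖1 - u‖⁻¹ ^ 2 / 2 * (A / (‖liMap u / 2‖ ^ (2 * ν) * (liMap u / 2).re)) := by
        gcongr
        exact hA _ hw
    _ = A * 4 ^ ν * ‖1 - u‖ ^ (2 * ν) / (1 - u.re) := by
        rw [hn2, hreL, show (4 : ℝ) ^ ν = 2 ^ (2 * ν) by rw [pow_mul]; norm_num, div_pow, inv_pow,
          inv_pow]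
        field_simp

/-! ### The polynomial part and the splitting of the generating function -/

/-- `dᵐ/dzᵐ [c (1 − z)^j](0) = 0` for `m > j`. [folklore] -/
private theorem iteratedDeriv_const_mul_one_sub_pow_eq_zero {j m : ℕ} (h : j < m) (c : ℂ) :
    iteratedDeriv m (fun z : ℂ ↦ c * (1 - z) ^ j) 0 = 0 := by
  rw [iteratedDeriv_const_mul_field]
  have hcs := iteratedDeriv_comp_const_sub (n := m) (f := fun x : ℂ ↦ x ^ j) (s := (1 : ℂ))
  rw [hcs]
  simp [iteratedDeriv_pow, Nat.descFactorial_eq_zero_iff_lt.2 h]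

/-- The higher Stirling terms `P_ν(z) = Σ_{k=2}^{ν} (B_{2k}/2k) 2^{2k−1} (1−z)^{2k−2}` form a polynomial of
degree `≤ 2ν − 2`: `dᵐP_ν/dzᵐ(0) = 0` for `m > 2ν − 2`. [folklore] -/
private theorem iteratedDeriv_trendPoly_eq_zero {ν m : ℕ} (hm : 2 * ν - 2 < m) :
    iteratedDeriv m (fun z : ℂ ↦ ∑ k ∈ Finset.Icc 2 ν,
      (bernoulli (2 * k) : ℂ) / (2 * k) * 2 ^ (2 * k - 1) * (1 - z) ^ (2 * k - 2)) 0 = 0 := by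
  rw [iteratedDeriv_fun_sum (fun k _ ↦
    (contDiff_const.mul ((contDiff_const.sub contDiff_id).pow _)).contDiffAt)]
  refine Finset.sum_eq_zero fun k hk ↦ ?_
  have hk2 := (Finset.mem_Icc.1 hk).2
  exact iteratedDeriv_const_mul_one_sub_pow_eq_zero (by omega) _

/-- The polynomial part is smooth. [folklore] -/
private theorem contDiff_trendPoly (ν : ℕ) (m : ℕ) :
    ContDiff ℂ m (fun z : ℂ ↦ ∑ k ∈ Finset.Icc 2 ν,
      (bernoulli (2 * k) : ℂ) / (2 * k) * 2 ^ (2 * k - 1) * (1 - z) ^ (2 * k - 2)) :=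
  ContDiff.sum fun _ _ ↦ contDiff_const.mul ((contDiff_const.sub contDiff_id).pow _)

/-- **The splitting `𝒜 = E + Φ_ν − P_ν`** of the generating function of the trend, for every order
`ν ≥ 1` and every `z ≠ 1`: with `L = m(z)` and the Stirling remainder
`R_ν(w) = ψ(w) − (Log w − 1/(2w) − Σ_{k=1}^{ν} B_{2k}/(2k w^{2k}))`,
`L + (−Log π/2 + ψ(L/2)/2)L² = E(z) + (L²/2)R_ν(L/2) − P_ν(z)`. [cite: Voros2006, §4 eqs. (4.4)–(4.5)] -/
theorem trendGen_eq {ν : ℕ} (hν : 1 ≤ ν) {z : ℂ} (hz : z ≠ 1) :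
    liMap z + (-(Complex.log Real.pi) / 2 + Complex.digamma (liMap z / 2) / 2) * liMap z ^ 2 =
      (liMap z / 2 - 1 / 6 - (Real.log Real.pi : ℂ) / 2 * liMap z ^ 2 +
          liMap z ^ 2 * Complex.log (liMap z / 2) / 2) +
        liMap z ^ 2 / 2 * (Complex.digamma (liMap z / 2) - (Complex.log (liMap z / 2) -
          1 / (2 * (liMap z / 2)) - ∑ k ∈ Finset.Icc 1 ν,
            (bernoulli (2 * k) : ℂ) / (2 * k) / (liMap z / 2) ^ (2 * k))) -
        ∑ k ∈ Finset.Icc 2 ν,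
          (bernoulli (2 * k) : ℂ) / (2 * k) * 2 ^ (2 * k - 1) * (1 - z) ^ (2 * k - 2) := by
  have hL0 : liMap z ≠ 0 := liMap_ne_zero hz
  have h1z : (1 : ℂ) - z ≠ 0 := sub_ne_zero.2 hz.symm
  -- termwise: `(L²/2)·B_{2k}/(2k (L/2)^{2k}) = (B_{2k}/2k) 2^{2k−1} (1−z)^{2k−2}`
  have hterm : ∀ k : ℕ, 1 ≤ k →
      liMap z ^ 2 / 2 * ((bernoulli (2 * k) : ℂ) / (2 * k) / (liMap z / 2) ^ (2 * k)) =
        (bernoulli (2 * k) : ℂ) / (2 * k) * 2 ^ (2 * k - 1) * (1 - z) ^ (2 * k - 2) := by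
    intro k hk
    obtain ⟨j, rfl⟩ : ∃ j, k = j + 1 := ⟨k - 1, by omega⟩
    have hk0 : ((j : ℂ) + 1) ≠ 0 := by exact_mod_cast Nat.succ_ne_zero j
    rw [show 2 * (j + 1) - 1 = 2 * j + 1 by omega, show 2 * (j + 1) - 2 = 2 * j by omega,
      show liMap z = (1 - z)⁻¹ from rfl]
    generalize (1 : ℂ) - z = y at h1z ⊢
    push_cast
    rw [show 2 * (j + 1) = 2 * j + 2 by ring, div_pow, inv_pow, inv_pow]
    field_simp
    ring
  have hsplit : ∑ k ∈ Finset.Icc 1 ν, (bernoulli (2 * k) : ℂ) / (2 * k) / (liMap z / 2) ^ (2 * k) =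
      (bernoulli 2 : ℂ) / 2 / (liMap z / 2) ^ 2 +
        ∑ k ∈ Finset.Icc 2 ν, (bernoulli (2 * k) : ℂ) / (2 * k) / (liMap z / 2) ^ (2 * k) := by
    have hI : Finset.Icc 1 ν = insert 1 (Finset.Icc 2 ν) := by
      ext k; simp only [Finset.mem_insert, Finset.mem_Icc]; omega
    rw [hI, Finset.sum_insert (by simp)]
    norm_num
  have hpoly : liMap z ^ 2 / 2 * ∑ k ∈ Finset.Icc 2 ν,
      (bernoulli (2 * k) : ℂ) / (2 * k) / (liMap z / 2) ^ (2 * k) =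
      ∑ k ∈ Finset.Icc 2 ν, (bernoulli (2 * k) : ℂ) / (2 * k) * 2 ^ (2 * k - 1) * (1 - z) ^ (2 * k - 2) := by
    rw [Finset.mul_sum]
    refine Finset.sum_congr rfl fun k hk ↦ hterm k ?_
    exact le_trans one_le_two (Finset.mem_Icc.1 hk).1
  have hb : (bernoulli 2 : ℂ) = 1 / 6 := by
    rw [bernoulli_eq_bernoulli'_of_ne_one (by norm_num), bernoulli'_two]; push_cast; ring
  rw [hsplit, hb, ← hpoly, Complex.ofReal_log Real.pi_pos.le]
  field_simp
  ring

end VorosTS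

open VorosTS in
/-- **RH-FREE.  Discharge of `Voros2006_eqTS`** ([Voros2006] §4, eqs. (4.4)–(TS), p.7, «unconditionally»):
for every `N`,

  `liTrend n − ((n/2)(H_n − 1 − log 2π) + 1/2) = o(n^{−N})`   (`n → ∞`),

i.e. the full asymptotic expansion of the trend `S̄_n ∼ ½ n(log n − 1 + γ − log 2π) + 3/4 − Σ_{k≥1}
B_{2k}/(4k) n^{1−2k}`.  Proof: steps 1–6 of the module docstring (generating function, Stirling's series
of order `ν = N + 2` for `ψ`, the higher Stirling terms are polynomials in `z`, Cauchy's estimates for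
the `(N+1)`-st derivative of the remainder part); a deviation from the printed Nörlund–Rice argument,
recorded there. [cite: Voros2006, §4 eqs. (4.4), (TS) p.7] -/
theorem Voros2006_eqTS_holds : Voros2006_eqTS := by
  intro N
  -- orders: `K = N + 1` derivatives, Stirling of order `ν = N + 2`
  set K : ℕ := N + 1 with hK
  set ν : ℕ := N + 2 with hν
  set A : ℝ := Real.pi ^ 2 / 3 * ((2 * ν + 1).factorial : ℝ) / (2 * Real.pi) ^ (2 * ν + 1) with hA
  have hA0 : 0 ≤ A := by positivity
  -- the Stirling remainder of order `ν`
  set R : ℂ → ℂ := fun w ↦ Complex.digamma w - (Complex.log w - 1 / (2 * w) -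
      ∑ k ∈ Finset.Icc 1 ν, (bernoulli (2 * k) : ℂ) / (2 * k) / w ^ (2 * k)) with hR
  have hopenH : IsOpen {w : ℂ | 0 < w.re} := isOpen_lt continuous_const Complex.continuous_re
  have hRd : DifferentiableOn ℂ R {w : ℂ | 0 < w.re} := by
    intro w hw
    have hw' : 0 < w.re := hw
    have hw0 : w ≠ 0 := fun h ↦ by rw [h] at hw'; simp at hw'
    have hψ : DifferentiableAt ℂ Complex.digamma w :=
      (Literature.Analysis.SpecialFunctions.Complex.differentiableOn_digamma _ hw').differentiableAt
        (hopenH.mem_nhds hw')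
    have hlog : DifferentiableAt ℂ Complex.log w :=
      Complex.differentiableAt_log (Complex.mem_slitPlane_iff.2 (Or.inl hw'))
    have hinv : DifferentiableAt ℂ (fun w : ℂ ↦ 1 / (2 * w)) w :=
      (differentiableAt_const _).div ((differentiableAt_const _).mul differentiableAt_id)
        (mul_ne_zero two_ne_zero hw0)
    have hsum : DifferentiableAt ℂ (fun w : ℂ ↦ ∑ k ∈ Finset.Icc 1 ν,
        (bernoulli (2 * k) : ℂ) / (2 * k) / w ^ (2 * k)) w :=
      DifferentiableAt.fun_sum fun k _ ↦
        (differentiableAt_const _).div (differentiableAt_pow _) (pow_ne_zero _ hw0)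
    exact (hψ.sub ((hlog.sub hinv).sub hsum)).differentiableWithinAt
  have hRb : ∀ w : ℂ, 0 < w.re → ‖R w‖ ≤ A / (‖w‖ ^ (2 * ν) * w.re) := fun w hw ↦
    Literature.Analysis.SpecialFunctions.Complex.norm_digamma_sub_stirlingSeries_le hw (by omega)
  -- the remainder part `Φ_ν = (L²/2) R(L/2)`
  set Φ : ℂ → ℂ := fun z ↦ liMap z ^ 2 / 2 * R (liMap z / 2) with hΦ
  have hΦd : DifferentiableOn ℂ Φ {z : ℂ | z.re < 1} := differentiableOn_rem hRd
  have hΦb : ∀ u : ℂ, u.re < 1 → ‖Φ u‖ ≤ A * 4 ^ ν * ‖1 - u‖ ^ (2 * ν) / (1 - u.re) :=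
    fun u hu ↦ norm_rem_le hRb hu
  have hΦK : ∀ z ∈ ball (0 : ℂ) 1, ‖iteratedDeriv K Φ z‖ ≤ K ! * (A * 4 ^ ν * 4 ^ (2 * ν)) :=
    fun z hz ↦ norm_iteratedDeriv_le_of_growth (by positivity) (by omega : 2 * K + 2 ≤ 2 * ν) hΦd hΦb
      (by simpa using hz)
  set M : ℝ := K ! * (A * 4 ^ ν * 4 ^ (2 * ν)) with hM
  have hM0 : 0 ≤ M := by positivity
  have hcoef : ∀ j : ℕ, ‖iteratedDeriv (j + K) Φ 0‖ ≤ j ! * M := norm_iteratedDeriv_add_le hΦd hΦK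
  -- the exact error for `m ≥ 2ν` (`n = m + 1`)
  have hopen : IsOpen {z : ℂ | z.re < 1} := isOpen_lt Complex.continuous_re continuous_const
  have h0mem : (0 : ℂ) ∈ {z : ℂ | z.re < 1} := by simp
  have hexact : ∀ m : ℕ, 2 * ν ≤ m →
      liTrend (m + 1) - (((m + 1 : ℕ) : ℝ) / 2 * ((harmonic (m + 1) : ℝ) - 1 - Real.log (2 * Real.pi)) +
        1 / 2) = (iteratedDeriv m Φ 0 / (m ! : ℂ)).re := by
    intro m hm
    rw [← keiperLiCoeff_sub_osc_eq_liTrend (by omega : 1 ≤ m + 1),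
      keiperLiCoeff_sub_osc_eq_iteratedDeriv (by omega : 1 ≤ m + 1), Nat.add_sub_cancel]
    have hev : (fun z ↦ liMap z + (-(Complex.log Real.pi) / 2 + Complex.digamma (liMap z / 2) / 2) *
        liMap z ^ 2) =ᶠ[𝓝 (0 : ℂ)] fun z ↦ (liMap z / 2 - 1 / 6 - (Real.log Real.pi : ℂ) / 2 *
          liMap z ^ 2 + liMap z ^ 2 * Complex.log (liMap z / 2) / 2) + Φ z -
        ∑ k ∈ Finset.Icc 2 ν,
          (bernoulli (2 * k) : ℂ) / (2 * k) * 2 ^ (2 * k - 1) * (1 - z) ^ (2 * k - 2) := by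
      filter_upwards [eventually_ne_nhds (zero_ne_one : (0 : ℂ) ≠ 1)] with z hz
      simp only [hΦ, hR]
      exact trendGen_eq (by omega) hz
    have hE : ContDiffAt ℂ m (fun z ↦ liMap z / 2 - 1 / 6 - (Real.log Real.pi : ℂ) / 2 *
        liMap z ^ 2 + liMap z ^ 2 * Complex.log (liMap z / 2) / 2) 0 :=
      analyticAt_trendElem_zero.contDiffAt
    have hΦc : ContDiffAt ℂ m Φ 0 := (hΦd.analyticAt (hopen.mem_nhds h0mem)).contDiffAt
    have hPc : ContDiffAt ℂ m (fun z : ℂ ↦ ∑ k ∈ Finset.Icc 2 ν,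
        (bernoulli (2 * k) : ℂ) / (2 * k) * 2 ^ (2 * k - 1) * (1 - z) ^ (2 * k - 2)) 0 :=
      (contDiff_trendPoly ν m).contDiffAt
    rw [hev.iteratedDeriv_eq, iteratedDeriv_fun_sub (hE.add hΦc) hPc, iteratedDeriv_fun_add hE hΦc,
      iteratedDeriv_trendElem_zero, iteratedDeriv_trendPoly_eq_zero (by omega), sub_zero,
      if_neg (by omega)]
    have hfpos : (0 : ℝ) < m ! := by exact_mod_cast Nat.factorial_pos m
    have hX : (m ! : ℂ) * (((m : ℂ) + 1) / 2 * ((((harmonic (m + 1) : ℚ) : ℝ) : ℂ) - 1 - Real.log 2 -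
        Real.log Real.pi) + 1 / 2 - 0) =
        (((m ! : ℝ) * (((m : ℝ) + 1) / 2 * (((harmonic (m + 1) : ℚ) : ℝ) - 1 - Real.log 2 -
          Real.log Real.pi) + 1 / 2) : ℝ) : ℂ) := by
      push_cast; ring
    rw [hX, add_div, Complex.add_re, ← Complex.ofReal_natCast, ← Complex.ofReal_div, Complex.ofReal_re,
      mul_div_cancel_left₀ _ hfpos.ne', Real.log_mul two_ne_zero Real.pi_ne_zero]
    push_cast
    ring
  -- the bound `|error(n)| ≤ B/n^K` for `n ≥ 2ν + 1`
  set B : ℝ := M * ((K + 1 : ℕ) : ℝ) ^ K with hB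
  have hB0 : 0 ≤ B := by positivity
  have hbound : ∀ n : ℕ, 2 * ν + 1 ≤ n →
      |liTrend n - ((n : ℝ) / 2 * ((harmonic n : ℝ) - 1 - Real.log (2 * Real.pi)) + 1 / 2)| ≤
        B / (n : ℝ) ^ K := by
    intro n hn
    obtain ⟨m, rfl⟩ : ∃ m, n = m + 1 := ⟨n - 1, by omega⟩
    rw [hexact m (by omega)]
    obtain ⟨j, rfl⟩ : ∃ j, m = j + K := ⟨m - K, by omega⟩
    have h1 := hcoef j
    have hfpos : (0 : ℝ) < (j + K)! := by exact_mod_cast Nat.factorial_pos _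
    have hnat : j ! * (j + K + 1) ^ K ≤ (K + 1) ^ K * (j + K)! :=
      calc j ! * (j + K + 1) ^ K ≤ j ! * ((K + 1) * (j + 1)) ^ K :=
            Nat.mul_le_mul_left _ (Nat.pow_le_pow_left (by nlinarith) K)
        _ = (K + 1) ^ K * (j ! * (j + 1) ^ K) := by rw [mul_pow]; ring
        _ ≤ (K + 1) ^ K * (j + K)! := Nat.mul_le_mul_left _ Nat.factorial_mul_pow_le_factorial
    have hnat' : (j ! : ℝ) * ((j + K + 1 : ℕ) : ℝ) ^ K ≤ ((K + 1 : ℕ) : ℝ) ^ K * ((j + K)! : ℝ) := by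
      exact_mod_cast hnat
    have hnpos : (0 : ℝ) < ((j + K + 1 : ℕ) : ℝ) ^ K := by positivity
    calc |(iteratedDeriv (j + K) Φ 0 / ((j + K)! : ℂ)).re|
        ≤ ‖iteratedDeriv (j + K) Φ 0 / ((j + K)! : ℂ)‖ := Complex.abs_re_le_norm _
      _ = ‖iteratedDeriv (j + K) Φ 0‖ / (j + K)! := by rw [norm_div, Complex.norm_natCast]
      _ ≤ j ! * M / (j + K)! := by gcongr
      _ ≤ B / ((j + K + 1 : ℕ) : ℝ) ^ K := by
          rw [hB, div_le_div_iff₀ hfpos hnpos]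
          calc (j ! : ℝ) * M * ((j + K + 1 : ℕ) : ℝ) ^ K = M * ((j ! : ℝ) * ((j + K + 1 : ℕ) : ℝ) ^ K) := by
                ring
            _ ≤ M * (((K + 1 : ℕ) : ℝ) ^ K * ((j + K)! : ℝ)) := by gcongr
            _ = M * ((K + 1 : ℕ) : ℝ) ^ K * ((j + K)! : ℝ) := by ring
  -- `B/n^{N+1} = o(n^{−N})`
  rw [Asymptotics.isLittleO_iff]
  intro c hc
  obtain ⟨n₀, hn₀⟩ := exists_nat_gt (B / c)
  filter_upwards [eventually_ge_atTop (max (2 * ν + 1) (n₀ + 1))] with n hn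
  have hn1 : 2 * ν + 1 ≤ n := le_trans (le_max_left _ _) hn
  have hn2 : n₀ + 1 ≤ n := le_trans (le_max_right _ _) hn
  have hnpos : (0 : ℝ) < n := by exact_mod_cast (by omega : 0 < n)
  have h := hbound n hn1
  rw [Real.norm_eq_abs, Real.norm_eq_abs]
  refine h.trans ?_
  have hzpow : ((n : ℝ) ^ (-(N : ℤ))) = ((n : ℝ) ^ N)⁻¹ := by
    rw [zpow_neg, zpow_natCast]
  rw [hzpow, abs_of_pos (by positivity), hK, pow_succ, div_le_iff₀ (by positivity)]
  have e : c * ((n : ℝ) ^ N)⁻¹ * ((n : ℝ) ^ N * n) = c * n := by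
    field_simp
  rw [e]
  have hlt : B / c < n := lt_of_lt_of_le hn₀ (by exact_mod_cast (by omega : n₀ ≤ n))
  have := (div_lt_iff₀ hc).1 hlt
  linarith

end Literature.NumberTheory.LFunctions
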